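import Mathlib
import HarnessLib

/-!
# Route AeaCutRectangles — the TRANSVERSAL ENGINE behind the fixed-cut fooling measure
# (file 1 of 4 of the BC5 rung of the deciding crux `FoolingMeasure`, stmt-PneNP-19727)

For ANY unit system and ANY cut: a unit system is a frame `W` and units `π : ι → Finset (Sym2 V)`;
transversals `t` pick one edge per unit, their graphs are `tg W t = W ∪ range t`, and `mu W π` is the
uniform transversal measure (a probability measure as soon as every unit is non-empty: `mu_nonneg`,
`mu_sum`, `mu_support`).  Under **D2** (`gammaMinus W π i = W ∪ ⋃_(j ≠ i) π j` is 3-colourable for every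
unit `i`) two transversals lying in a common cut rectangle `𝓐 ⊗ 𝓑` over a cut `B` inside NON-3-COL choose
the same SIDE of `B` in every unit (`hybrid_subset`, `sides_agree` — the hybrid argument), hence
`card_rect_transversals_le`, `rect_mass_le` (mass `≤ ∏ max(aᵢ,bᵢ) / ∏ |πᵢ|`) and, for 2-edge units,
`rect_mass_le_half_pow`: the `mu`-mass of a cut rectangle is `≤ (1/2)^(number of units split by B)`.
Files 2–4 (`AeaCutRectanglesToftSystem`, `AeaCutRectanglesToftFooling`, `AeaCutRectanglesFixedCutFooling`)
instantiate the engine on the Toft unit system and derive the rung `foolingMeasure_fixedCut`.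

HONEST FRAMING: elementary finite combinatorics (Toft 1970-type critical graphs, a hybrid/fooling argument,
bookkeeping of an explicit measure); FRONTIER material for a rung of Fagin's complement ladder (NON-3-COL vs.
ESO(∀∃∀, arity 2)); nothing here bears on P vs NP, and the summit stays where it was.

Sources: programme archive 2001, pnp/generalized-spectra-complement/work/aea/AEA.md Def. 4.1, Thm. 4.2, Prop. 5.1,
§6; blind-check records bc-aea-rectangles (B)(D), bc-aea-cut37; B. Toft, "On the maximal number of edges of
critical k-chromatic graphs", Studia Sci. Math. Hungar. 5 (1970) 461–470 (the dense 4-critical graphs).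
-/

set_option linter.dupNamespace false -- `Summit.PneNP.PneNP.…`: summit = sub-problem name (D-0017 single-conjunct layout)

namespace Summit.PneNP.PneNP.Theorems.AeaCutRectanglesTransversalEngine

open Finset

/-! ### Unit systems, transversals, the uniform transversal measure -/

/-- The graph of the transversal `t`: the frame `W` plus the chosen edge of every unit. -/
def tg {V ι : Type*} [DecidableEq V] [Fintype ι] (W : Finset (Sym2 V)) (t : ι → Sym2 V) : Finset (Sym2 V) :=
  W ∪ univ.image t

/-- Membership in a transversal graph. -/
theorem mem_tg {V ι : Type*} [DecidableEq V] [Fintype ι] {W : Finset (Sym2 V)} {t : ι → Sym2 V} {e : Sym2 V} :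
    e ∈ tg W t ↔ e ∈ W ∨ ∃ j, t j = e := by
  simp [tg]

/-- The set of transversals of the unit system `π` (one edge from each unit). -/
def transversals {V ι : Type*} [Fintype ι] [DecidableEq ι] (π : ι → Finset (Sym2 V)) : Finset (ι → Sym2 V) :=
  Fintype.piFinset π

/-- Membership in `transversals π`. -/
theorem mem_transversals {V ι : Type*} [Fintype ι] [DecidableEq ι] {π : ι → Finset (Sym2 V)} {t : ι → Sym2 V} :
    t ∈ transversals π ↔ ∀ i, t i ∈ π i :=
  Fintype.mem_piFinset

/-- `|transversals π| = ∏ᵢ |πᵢ|`. -/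
theorem card_transversals {V ι : Type*} [Fintype ι] [DecidableEq ι] (π : ι → Finset (Sym2 V)) :
    (transversals π).card = ∏ i, (π i).card :=
  Fintype.card_piFinset π

/-- `Γ − πᵢ`: the frame and every unit except unit `i`. -/
def gammaMinus {V ι : Type*} [DecidableEq V] [Fintype ι] [DecidableEq ι] (W : Finset (Sym2 V))
    (π : ι → Finset (Sym2 V)) (i : ι) : Finset (Sym2 V) :=
  W ∪ (univ.filter fun j => j ≠ i).biUnion π

/-- Membership in `Γ − πᵢ`. -/
theorem mem_gammaMinus {V ι : Type*} [DecidableEq V] [Fintype ι] [DecidableEq ι] {W : Finset (Sym2 V)}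
    {π : ι → Finset (Sym2 V)} {i : ι} {e : Sym2 V} :
    e ∈ gammaMinus W π i ↔ e ∈ W ∨ ∃ j, j ≠ i ∧ e ∈ π j := by
  simp [gammaMinus]

/-- The UNIFORM TRANSVERSAL MEASURE pushed forward to edge sets:
`mu W π S = #{t : tg W t = S} / #transversals`. -/
noncomputable def mu {V ι : Type*} [DecidableEq V] [Fintype ι] [DecidableEq ι] (W : Finset (Sym2 V))
    (π : ι → Finset (Sym2 V)) (S : Finset (Sym2 V)) : ℝ :=
  (((transversals π).filter fun t => tg W t = S).card : ℝ) / (transversals π).card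

/-- `mu ≥ 0`. -/
theorem mu_nonneg {V ι : Type*} [DecidableEq V] [Fintype ι] [DecidableEq ι] (W : Finset (Sym2 V))
    (π : ι → Finset (Sym2 V)) (S : Finset (Sym2 V)) : 0 ≤ mu W π S :=
  div_nonneg (Nat.cast_nonneg _) (Nat.cast_nonneg _)

/-- `mu` is a probability measure as soon as every unit is non-empty. -/
theorem mu_sum {V ι : Type*} [Fintype V] [DecidableEq V] [Fintype ι] [DecidableEq ι] (W : Finset (Sym2 V))
    {π : ι → Finset (Sym2 V)} (hne : ∀ i, (π i).Nonempty) : ∑ S, mu W π S = 1 := by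
  have hT : 0 < (transversals π).card := by
    rw [card_transversals]
    exact prod_pos fun i _ => card_pos.2 (hne i)
  have h := card_eq_sum_card_fiberwise (f := tg W) (s := transversals π)
    (t := (univ : Finset (Finset (Sym2 V)))) fun _ _ => mem_univ _
  unfold mu
  rw [← sum_div, div_eq_one_iff_eq (by exact_mod_cast hT.ne')]
  exact_mod_cast h.symm

/-- The support of `mu` consists of transversal graphs. -/
theorem mu_support {V ι : Type*} [DecidableEq V] [Fintype ι] [DecidableEq ι] {W : Finset (Sym2 V)}
    {π : ι → Finset (Sym2 V)} {S : Finset (Sym2 V)} (h : mu W π S ≠ 0) :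
    ∃ t : ι → Sym2 V, (∀ i, t i ∈ π i) ∧ tg W t = S := by
  have hne : ((transversals π).filter fun t => tg W t = S).Nonempty := by
    rw [nonempty_iff_ne_empty]
    intro he
    apply h
    simp [mu, he]
  obtain ⟨t, ht⟩ := hne
  rw [mem_filter, mem_transversals] at ht
  exact ⟨t, ht.1, ht.2⟩

/-! ### The hybrid argument -/

/-- If `t` chooses unit `i` INSIDE `B` and `t'` chooses it NOT inside, then the hybrid of a non-inside part of
`tg W t` with an inside part of `tg W t'` misses unit `i` entirely. -/
theorem hybrid_subset {V ι : Type*} [DecidableEq V] [Fintype ι] [DecidableEq ι] {W : Finset (Sym2 V)}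
    {π : ι → Finset (Sym2 V)} {B : Finset V} {t t' : ι → Sym2 V}
    (ht : ∀ j, t j ∈ π j) (ht' : ∀ j, t' j ∈ π j) {α β' : Finset (Sym2 V)}
    (hα : α ⊆ tg W t) (hβ' : β' ⊆ tg W t') (hαout : ∀ e ∈ α, ¬ ∀ v ∈ e, v ∈ B)
    (hβ'in : ∀ e ∈ β', ∀ v ∈ e, v ∈ B)
    {i : ι} (hi : ∀ v ∈ t i, v ∈ B) (hi' : ¬ ∀ v ∈ t' i, v ∈ B) : α ∪ β' ⊆ gammaMinus W π i := by
  intro e he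
  rw [mem_gammaMinus]
  rcases mem_union.1 he with he | he
  · rcases mem_tg.1 (hα he) with hw | ⟨j, rfl⟩
    · exact Or.inl hw
    · refine Or.inr ⟨j, ?_, ht j⟩
      rintro rfl
      exact hαout _ he hi
  · rcases mem_tg.1 (hβ' he) with hw | ⟨j, rfl⟩
    · exact Or.inl hw
    · refine Or.inr ⟨j, ?_, ht' j⟩
      rintro rfl
      exact hi' (hβ'in _ he)

/-- **Sides agree** (AEA.md Thm. 4.2, CLAIM): under D2, two transversals whose graphs lie in one cut rectangle over
`B` inside NON-3-COL choose, in every unit, edges on the same side of `B`. -/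
theorem sides_agree {V ι : Type*} [DecidableEq V] [Fintype ι] [DecidableEq ι] {W : Finset (Sym2 V)}
    {π : ι → Finset (Sym2 V)} {B : Finset V}
    (hD2 : ∀ i, (SimpleGraph.fromEdgeSet (↑(gammaMinus W π i) : Set (Sym2 V))).Colorable 3)
    {𝓐 𝓑 : Finset (Finset (Sym2 V))}
    (h𝓐 : ∀ α ∈ 𝓐, ∀ e ∈ α, ∃ v ∈ e, v ∉ B) (h𝓑 : ∀ β ∈ 𝓑, ∀ e ∈ β, ∀ v ∈ e, v ∈ B)
    (hN : ∀ α ∈ 𝓐, ∀ β ∈ 𝓑, ¬ (SimpleGraph.fromEdgeSet ((α ∪ β : Finset (Sym2 V)) : Set (Sym2 V))).Colorable 3)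
    {α β α' β' : Finset (Sym2 V)} (hα : α ∈ 𝓐) (hβ : β ∈ 𝓑) (hα' : α' ∈ 𝓐) (hβ' : β' ∈ 𝓑)
    {t t' : ι → Sym2 V} (ht : ∀ j, t j ∈ π j) (ht' : ∀ j, t' j ∈ π j)
    (htg : tg W t = α ∪ β) (htg' : tg W t' = α' ∪ β') (i : ι) :
    ((∀ v ∈ t i, v ∈ B) ↔ ∀ v ∈ t' i, v ∈ B) := by
  have outA : ∀ γ ∈ 𝓐, ∀ e ∈ γ, ¬ ∀ v ∈ e, v ∈ B := fun γ hγ e he hin => by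
    obtain ⟨v, hv, hvB⟩ := h𝓐 γ hγ e he
    exact hvB (hin v hv)
  have col : ∀ {γ δ : Finset (Sym2 V)} (j : ι), γ ∪ δ ⊆ gammaMinus W π j →
      (SimpleGraph.fromEdgeSet ((γ ∪ δ : Finset (Sym2 V)) : Set (Sym2 V))).Colorable 3 :=
    fun j h => (hD2 j).mono_left (SimpleGraph.fromEdgeSet_mono (Finset.coe_subset.2 h))
  constructor
  · intro hi
    by_contra hi'
    exact hN α hα β' hβ' (col i (hybrid_subset ht ht' (by rw [htg]; exact subset_union_left)
      (by rw [htg']; exact subset_union_right) (outA α hα) (h𝓑 β' hβ') hi hi'))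
  · intro hi'
    by_contra hi
    exact hN α' hα' β hβ (col i (hybrid_subset ht' ht (by rw [htg']; exact subset_union_left)
      (by rw [htg]; exact subset_union_right) (outA α' hα') (h𝓑 β hβ) hi' hi))

/-- The non-inside part and the inside part of a decomposition `α ∪ β` determine each other. -/
theorem parts_unique {V : Type*} [DecidableEq V] {B : Finset V} {α β α' β' : Finset (Sym2 V)}
    (h : α ∪ β = α' ∪ β')
    (hα : ∀ e ∈ α, ∃ v ∈ e, v ∉ B) (hα' : ∀ e ∈ α', ∃ v ∈ e, v ∉ B)
    (hβ : ∀ e ∈ β, ∀ v ∈ e, v ∈ B) (hβ' : ∀ e ∈ β', ∀ v ∈ e, v ∈ B) : α = α' ∧ β = β' := by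
  have disj : ∀ e : Sym2 V, (∃ v ∈ e, v ∉ B) → (∀ v ∈ e, v ∈ B) → False :=
    fun e ⟨v, hv, hvB⟩ hall => hvB (hall v hv)
  refine ⟨Subset.antisymm (fun e he => ?_) (fun e he => ?_), Subset.antisymm (fun e he => ?_) (fun e he => ?_)⟩
  · have : e ∈ α' ∪ β' := h ▸ mem_union_left _ he
    rcases mem_union.1 this with h' | h'
    · exact h'
    · exact (disj e (hα e he) (hβ' e h')).elim
  · have : e ∈ α ∪ β := h.symm ▸ mem_union_left _ he
    rcases mem_union.1 this with h' | h'
    · exact h'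
    · exact (disj e (hα' e he) (hβ e h')).elim
  · have : e ∈ α' ∪ β' := h ▸ mem_union_right _ he
    rcases mem_union.1 this with h' | h'
    · exact (disj e (hα' e h') (hβ e he)).elim
    · exact h'
  · have : e ∈ α ∪ β := h.symm ▸ mem_union_right _ he
    rcases mem_union.1 this with h' | h'
    · exact (disj e (hα e h') (hβ' e he)).elim
    · exact h'

/-! ### Counting the transversals in a rectangle -/

/-- **At most `∏ᵢ max(aᵢ, bᵢ)` transversals land in a cut rectangle inside NON-3-COL**, where `aᵢ` (`bᵢ`) is
the number of inside (non-inside) edges of unit `i`: all such transversals share one side-pattern. -/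
theorem card_rect_transversals_le {V ι : Type*} [Fintype V] [DecidableEq V] [Fintype ι] [DecidableEq ι]
    {W : Finset (Sym2 V)} {π : ι → Finset (Sym2 V)} {B : Finset V}
    (hD2 : ∀ i, (SimpleGraph.fromEdgeSet (↑(gammaMinus W π i) : Set (Sym2 V))).Colorable 3)
    {𝓐 𝓑 : Finset (Finset (Sym2 V))}
    (h𝓐 : ∀ α ∈ 𝓐, ∀ e ∈ α, ∃ v ∈ e, v ∉ B) (h𝓑 : ∀ β ∈ 𝓑, ∀ e ∈ β, ∀ v ∈ e, v ∈ B)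
    (hN : ∀ α ∈ 𝓐, ∀ β ∈ 𝓑, ¬ (SimpleGraph.fromEdgeSet ((α ∪ β : Finset (Sym2 V)) : Set (Sym2 V))).Colorable 3) :
    (((𝓐 ×ˢ 𝓑) ×ˢ transversals π).filter fun x => tg W x.2 = x.1.1 ∪ x.1.2).card
      ≤ ∏ i, max (((π i).filter fun e => ∀ v ∈ e, v ∈ B).card)
          (((π i).filter fun e => ¬ ∀ v ∈ e, v ∈ B).card) := by
  set H := ((𝓐 ×ˢ 𝓑) ×ˢ transversals π).filter fun x => tg W x.2 = x.1.1 ∪ x.1.2 with hH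
  have memH : ∀ x, x ∈ H ↔ ((x.1.1 ∈ 𝓐 ∧ x.1.2 ∈ 𝓑) ∧ ∀ i, x.2 i ∈ π i) ∧ tg W x.2 = x.1.1 ∪ x.1.2 := by
    intro x
    simp only [hH, mem_filter, mem_product, mem_transversals]
  rcases H.eq_empty_or_nonempty with h0 | ⟨x₀, hx₀⟩
  · rw [h0, card_empty]
    exact Nat.zero_le _
  · rw [memH] at hx₀
    -- the projection to the transversal is injective on H
    have hinj : Set.InjOn (fun x : (Finset (Sym2 V) × Finset (Sym2 V)) × (ι → Sym2 V) => x.2) ↑H := by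
      rintro ⟨⟨α, β⟩, t⟩ hx ⟨⟨α', β'⟩, t'⟩ hx' htt
      rw [Finset.mem_coe, memH] at hx hx'
      simp only at htt hx hx'
      subst htt
      obtain ⟨rfl, rfl⟩ := parts_unique (B := B) (hx.2.symm.trans hx'.2) (h𝓐 α hx.1.1.1) (h𝓐 α' hx'.1.1.1)
        (h𝓑 β hx.1.1.2) (h𝓑 β' hx'.1.1.2)
      rfl
    rw [← card_image_of_injOn hinj]
    -- its image lies in the transversals with x₀'s side pattern
    have hsub : H.image (fun x => x.2) ⊆
        Fintype.piFinset fun i => (π i).filter fun e => ((∀ v ∈ e, v ∈ B) ↔ ∀ v ∈ x₀.2 i, v ∈ B) := by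
      intro t ht
      rw [mem_image] at ht
      obtain ⟨x, hx, rfl⟩ := ht
      rw [memH] at hx
      rw [Fintype.mem_piFinset]
      intro i
      rw [mem_filter]
      exact ⟨hx.1.2 i, sides_agree hD2 h𝓐 h𝓑 hN hx.1.1.1 hx.1.1.2 hx₀.1.1.1 hx₀.1.1.2 hx.1.2 hx₀.1.2
        hx.2 hx₀.2 i⟩
    refine (card_le_card hsub).trans ?_
    rw [Fintype.card_piFinset]
    refine prod_le_prod (fun i _ => Nat.zero_le _) fun i _ => ?_
    by_cases hσ : ∀ v ∈ x₀.2 i, v ∈ B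
    · refine le_trans (card_le_card fun e he => ?_) (le_max_left _ _)
      rw [mem_filter] at he ⊢
      exact ⟨he.1, he.2.2 hσ⟩
    · refine le_trans (card_le_card fun e he => ?_) (le_max_right _ _)
      rw [mem_filter] at he ⊢
      exact ⟨he.1, fun h => hσ (he.2.1 h)⟩

/-! ### The rectangle mass bounds -/

/-- **Transversal engine** (AEA.md Thm. 4.2 CLAIM, general form): for every unit system satisfying D2 (with an
empty unit there are no transversals, `mu = 0` and the bound reads `0 ≤ 0`), every cut `B` and every cut rectangle `𝓐 ⊗ 𝓑` over `B` inside NON-3-COL (X1's three hypotheses,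
letter for letter), the `mu`-mass of the rectangle is at most `(∏ᵢ max(aᵢ,bᵢ)) / ∏ᵢ |πᵢ|`. -/
theorem rect_mass_le {V ι : Type*} [Fintype V] [DecidableEq V] [Fintype ι] [DecidableEq ι]
    {W : Finset (Sym2 V)} {π : ι → Finset (Sym2 V)} {B : Finset V}
    (hD2 : ∀ i, (SimpleGraph.fromEdgeSet (↑(gammaMinus W π i) : Set (Sym2 V))).Colorable 3)
    (𝓐 𝓑 : Finset (Finset (Sym2 V)))
    (h𝓐 : ∀ α ∈ 𝓐, ∀ e ∈ α, ¬ e.IsDiag ∧ ∃ v ∈ e, v ∉ B)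
    (h𝓑 : ∀ β ∈ 𝓑, ∀ e ∈ β, ¬ e.IsDiag ∧ ∀ v ∈ e, v ∈ B)
    (hN : ∀ α ∈ 𝓐, ∀ β ∈ 𝓑, ¬ (SimpleGraph.fromEdgeSet ((α ∪ β : Finset (Sym2 V)) : Set (Sym2 V))).Colorable 3) :
    ∑ q ∈ 𝓐 ×ˢ 𝓑, mu W π (q.1 ∪ q.2) ≤
      ((∏ i, max (((π i).filter fun e => ∀ v ∈ e, v ∈ B).card)
          (((π i).filter fun e => ¬ ∀ v ∈ e, v ∈ B).card) : ℕ) : ℝ) / (transversals π).card := by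
  set H := ((𝓐 ×ˢ 𝓑) ×ˢ transversals π).filter fun x => tg W x.2 = x.1.1 ∪ x.1.2 with hH
  have hHle := card_rect_transversals_le hD2 (fun α hα e he => (h𝓐 α hα e he).2)
    (fun β hβ e he => (h𝓑 β hβ e he).2) hN
  have hcount : H.card = ∑ q ∈ 𝓐 ×ˢ 𝓑, ((transversals π).filter fun t => tg W t = q.1 ∪ q.2).card := by
    have h1 : ∀ q : Finset (Sym2 V) × Finset (Sym2 V),
        ((transversals π).filter fun t => tg W t = q.1 ∪ q.2).card
          = ∑ t ∈ transversals π, if tg W t = q.1 ∪ q.2 then 1 else 0 := fun q => card_filter _ _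
    simp only [h1]
    rw [hH, card_filter]
    exact sum_product _ _ _
  have hsum : ∑ q ∈ 𝓐 ×ˢ 𝓑, mu W π (q.1 ∪ q.2) = (H.card : ℝ) / (transversals π).card := by
    simp only [mu]
    rw [← sum_div, hcount, Nat.cast_sum]
  rw [hsum]
  have hHle' : (H.card : ℝ) ≤ ((∏ i, max (((π i).filter fun e => ∀ v ∈ e, v ∈ B).card)
      (((π i).filter fun e => ¬ ∀ v ∈ e, v ∈ B).card) : ℕ) : ℝ) := by
    rw [hH]
    exact_mod_cast hHle
  exact div_le_div_of_nonneg_right hHle' (Nat.cast_nonneg _)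

/-- **Split units halve the mass**: with 2-edge units, a cut rectangle over `B` inside NON-3-COL has `mu`-mass at
most `(1/2)^{|I|}` for any set `I` of units SPLIT by `B` (one edge inside `B`, another not).  For a unit system
whose every near-bisection `B` splits `s(B)` units this is exactly the shape of X1's bound, with `2^{-s(B)}`. -/
theorem rect_mass_le_half_pow {V ι : Type*} [Fintype V] [DecidableEq V] [Fintype ι] [DecidableEq ι]
    {W : Finset (Sym2 V)} {π : ι → Finset (Sym2 V)} (h2 : ∀ i, (π i).card = 2) {B : Finset V}
    (hD2 : ∀ i, (SimpleGraph.fromEdgeSet (↑(gammaMinus W π i) : Set (Sym2 V))).Colorable 3)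
    (I : Finset ι) (hI : ∀ i ∈ I, (∃ e ∈ π i, ∀ v ∈ e, v ∈ B) ∧ (∃ e ∈ π i, ∃ v ∈ e, v ∉ B))
    (𝓐 𝓑 : Finset (Finset (Sym2 V)))
    (h𝓐 : ∀ α ∈ 𝓐, ∀ e ∈ α, ¬ e.IsDiag ∧ ∃ v ∈ e, v ∉ B)
    (h𝓑 : ∀ β ∈ 𝓑, ∀ e ∈ β, ¬ e.IsDiag ∧ ∀ v ∈ e, v ∈ B)
    (hN : ∀ α ∈ 𝓐, ∀ β ∈ 𝓑, ¬ (SimpleGraph.fromEdgeSet ((α ∪ β : Finset (Sym2 V)) : Set (Sym2 V))).Colorable 3) :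
    ∑ q ∈ 𝓐 ×ˢ 𝓑, mu W π (q.1 ∪ q.2) ≤ (1 / 2 : ℝ) ^ I.card := by
  refine (rect_mass_le hD2 𝓐 𝓑 h𝓐 h𝓑 hN).trans ?_
  -- the two counts of unit i
  set a : ι → ℕ := fun i => ((π i).filter fun e => ∀ v ∈ e, v ∈ B).card with ha
  set b : ι → ℕ := fun i => ((π i).filter fun e => ¬ ∀ v ∈ e, v ∈ B).card with hb
  have hab : ∀ i, a i + b i = 2 := fun i => by
    simp only [ha, hb]
    rw [card_filter_add_card_filter_not, h2 i]
  have hmax2 : ∀ i, max (a i) (b i) ≤ 2 := fun i => by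
    have := hab i
    omega
  have hmax1 : ∀ i ∈ I, max (a i) (b i) ≤ 1 := fun i hi => by
    obtain ⟨⟨e, he, hein⟩, ⟨e', he', v, hv, hvB⟩⟩ := hI i hi
    have ha1 : 1 ≤ a i := card_pos.2 ⟨e, mem_filter.2 ⟨he, hein⟩⟩
    have hb1 : 1 ≤ b i := card_pos.2 ⟨e', mem_filter.2 ⟨he', fun h => hvB (h v hv)⟩⟩
    have := hab i
    omega
  -- ∏ max ≤ 2^(#ι - #I)
  have hprod : ∏ i, max (a i) (b i) ≤ 2 ^ (Fintype.card ι - I.card) := by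
    calc ∏ i, max (a i) (b i) ≤ ∏ i, (if i ∈ I then 1 else 2) :=
          prod_le_prod (fun i _ => Nat.zero_le _) fun i _ => by
            split_ifs with h
            · exact hmax1 i h
            · exact hmax2 i
      _ = 2 ^ (Fintype.card ι - I.card) := by
          rw [prod_ite, prod_const_one, one_mul, prod_const]
          congr 1
          rw [filter_not, filter_mem_eq_inter, univ_inter, card_univ_sdiff]
  have hT : ((transversals π).card : ℝ) = 2 ^ Fintype.card ι := by
    rw [card_transversals]
    simp only [h2, prod_const, card_univ]
    push_cast
    rfl
  have hIle : I.card ≤ Fintype.card ι := card_le_univ I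
  rw [hT]
  calc ((∏ i, max (a i) (b i) : ℕ) : ℝ) / 2 ^ Fintype.card ι
      ≤ (2 : ℝ) ^ (Fintype.card ι - I.card) / 2 ^ Fintype.card ι := by
        gcongr
        exact_mod_cast hprod
    _ = (1 / 2 : ℝ) ^ I.card := by
        rw [pow_sub₀ (2 : ℝ) two_ne_zero hIle, one_div_pow]
        field_simp

end Summit.PneNP.PneNP.Theorems.AeaCutRectanglesTransversalEngine
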